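import Summits.Schanuel.Schanuel.Theorems.RootDecomp1BFinitePinningFloor04

/-!
# `RootDecomp1BFinitePinningFloor` — part 05 of 05 (`RootDecomp1BFinitePinningFloor05`): §9 K5-X SETTLED — the `(3+4i)/5` dichotomy (`β₀`, `β₀_pow_ne_one`, `s₀`, `γ₀`, `γ₀_transcendental` (Gelfond–Schneider), `linearIndependent_s₀I_piI`, `s₀_not_mem_spanOnePi` (Baker), `γ₀_or_γ₀_sq_not_mem` (the dichotomy), `kFiveX`, `kleinPolarCellOne_false_without_channel_beyond_periods`, `kleinPolarCellOne_false_without_channel_beyond_kernel_and_period_plane`): the period package does not buy even the first polar cell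

Part 5 of the port of the lens-4 gen-23 kernel `FinitePinningFloor.lean` (see part 01 for the overview, the construction of pinned shears and the reading for the crux). PORT in five parts (≤ 400 lines each, shared namespace `Summit.Schanuel.Schanuel.Theorems.RootDecomp1BFinitePinningFloor`, each part importing the previous; `--supports stmt-Schanuel-24622`) of the decomp-schanuel lens-4 kernel file `HOME/decomp-schanuel-lens-4/g23/FinitePinningFloor.lean` (gen 23, 2026-08-30, sha256 329db771b10b0bad…; `lean check` rc 0 · 0 sorry · standard axioms). 
-/

noncomputable section

open Complex

namespace Summit.Schanuel.Schanuel.Theorems.RootDecomp1BFinitePinningFloor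

open Summit.Schanuel.Schanuel.Theorems.RootDecomp1BTranscendencePackageFloor
open Summit.Schanuel.Schanuel.Theorems.RootDecomp1BPeriodKernelFloor
open Literature.NumberTheory.Transcendental (nesterenko baker_holds SchanuelRank transcendental_pi_holds)

/-! ## §1 Helpers (part-local copies of the private helpers of the kernel file) -/

/-- An element of an intermediate field `K` is algebraic over `K`. [folklore] -/
private theorem alg_of_mem {K : IntermediateField ℚ ℂ} {x : ℂ} (hx : x ∈ K) : IsAlgebraic K x :=
  isAlgebraic_algebraMap (⟨x, hx⟩ : K)

/-- `-1` is algebraic. [folklore] -/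
private theorem alg_neg_one : IsAlgebraic ℚ (-1 : ℂ) := by
  have h : IsAlgebraic ℚ ((-1 : ℤ) : ℂ) := isAlgebraic_int (-1)
  simpa using h

/-- `i` is algebraic. [folklore] -/
private theorem alg_I : IsAlgebraic ℚ I := mem_Qb_iff.mp I_mem_Qb

/-! ## §9 K5-X UNCONDITIONALLY: the `(3+4i)/5` DICHOTOMY — granted only Nesterenko for (P3) (as
every period-package statement here), the period package does not buy even the FIRST polar cell.
With `β₀ = (3+4i)/5` (algebraic, `|β₀| = 1`, not a root of unity), `s₀ = arg β₀` and `γ₀ = e^{s₀}`: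
Baker puts `s₀, 2s₀ ∉ A ⊕ Aπ`, Gelfond–Schneider makes `γ₀ = β₀^{-i}` transcendental, and the
`A`-independence of `1, π, π²` (transcendence of `π`) forbids `γ₀, γ₀² ∈ A ⊕ Aπ` SIMULTANEOUSLY; the
pinned shear `γ₀ ↦ s₀` (resp. `γ₀² ↦ 2s₀`) then has `E γ₀ = γ₀`, `E(iγ₀) = β₀` (resp. `E γ₀² = γ₀²`,
`E(iγ₀²) = β₀²`): a length-one cell of transcendence degree ONE. -/

/-- `β₀ = (3 + 4i)/5`. [folklore] -/
def β₀ : ℂ := (3 + 4 * I) / 5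

/-- `|β₀| = 1`. [folklore] -/
theorem norm_β₀ : ‖β₀‖ = 1 := by
  rw [β₀, norm_div]
  have h : ‖(3 : ℂ) + 4 * I‖ = 5 := by
    rw [Complex.norm_eq_sqrt_sq_add_sq]
    simp
    rw [show (3 : ℝ) ^ 2 + 4 ^ 2 = 5 ^ 2 by norm_num, Real.sqrt_sq (by norm_num)]
  rw [h]
  simp

/-- `β₀ ≠ 1`. [folklore] -/
theorem β₀_ne_one : β₀ ≠ 1 := by
  intro h
  have him := congrArg Complex.im h
  simp [β₀] at him

/-- `β₀` is algebraic. [folklore] -/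
theorem β₀_mem_Qb : β₀ ∈ Qb := by
  unfold β₀
  refine div_mem (add_mem (by simp) (mul_mem (by simp) I_mem_Qb)) (by simp)

/-- `β₀` is algebraic. [folklore] -/
theorem β₀_isAlgebraic : IsAlgebraic ℚ β₀ := mem_Qb_iff.mp β₀_mem_Qb

/-- `β₀⁻¹ = conj β₀ = (3 - 4i)/5`. [folklore] -/
theorem β₀_inv : β₀⁻¹ = (3 - 4 * I) / 5 := by
  refine inv_eq_of_mul_eq_one_right ?_
  rw [β₀]
  field_simp
  linear_combination (-16) * I_sq

/-- `β₀ + β₀⁻¹ = 6/5` — NOT an algebraic integer. [folklore] -/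
theorem β₀_add_inv : β₀ + β₀⁻¹ = 6 / 5 := by
  rw [β₀_inv, β₀]
  ring

/-- **`β₀` is not a root of unity**: otherwise `β₀` and `β₀⁻¹` are algebraic integers, hence so is
`β₀ + β₀⁻¹ = 6/5 ∈ ℚ ∖ ℤ`. [folklore] -/
theorem β₀_pow_ne_one {n : ℕ} (hn : n ≠ 0) : β₀ ^ n ≠ 1 := by
  intro h
  have hn' : 0 < n := Nat.pos_of_ne_zero hn
  have h1 : IsIntegral ℤ β₀ := IsIntegral.of_pow hn' (by rw [h]; exact isIntegral_one)
  have h2 : IsIntegral ℤ β₀⁻¹ :=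
    IsIntegral.of_pow hn' (by rw [inv_pow, h, inv_one]; exact isIntegral_one)
  have h3 : IsIntegral ℤ (algebraMap ℚ ℂ (6 / 5)) := by
    have e : algebraMap ℚ ℂ (6 / 5) = β₀ + β₀⁻¹ := by
      rw [β₀_add_inv, map_div₀]
      norm_num
    rw [e]
    exact h1.add h2
  have h4 : IsIntegral ℤ (6 / 5 : ℚ) := (isIntegral_algebraMap_iff (algebraMap ℚ ℂ).injective).mp h3
  obtain ⟨y, hy⟩ := IsIntegrallyClosed.isIntegral_iff.mp h4
  have hy' : (y : ℚ) = 6 / 5 := by simpa using hy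
  have h5 : ((5 * y : ℤ) : ℚ) = ((6 : ℤ) : ℚ) := by push_cast; rw [hy']; norm_num
  have h6 : 5 * y = 6 := by exact_mod_cast h5
  omega

/-- `s₀ = arg β₀ ∈ (0, π)`: the real number with `e^{is₀} = β₀`. [folklore] -/
def s₀ : ℝ := Complex.arg β₀

/-- `e^{i s₀} = β₀`. [folklore] -/
theorem exp_s₀_mul_I : cexp ((s₀ : ℂ) * I) = β₀ := by
  have h := Complex.norm_mul_exp_arg_mul_I β₀
  rw [norm_β₀] at h
  simpa [s₀] using h

/-- `s₀ ≠ 0`. [folklore] -/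
theorem s₀_ne_zero : s₀ ≠ 0 := by
  intro h
  have h1 := exp_s₀_mul_I
  rw [h] at h1
  simp at h1
  exact β₀_ne_one h1.symm

/-- `γ₀ = e^{s₀} > 0`. [folklore] -/
def γ₀ : ℝ := Real.exp s₀

/-- `γ₀ > 0`. [folklore] -/
theorem γ₀_pos : 0 < γ₀ := Real.exp_pos _

/-- `e^{s₀} = γ₀` in `ℂ`. [folklore] -/
theorem exp_s₀ : cexp (s₀ : ℂ) = (γ₀ : ℂ) := by
  rw [γ₀, Complex.ofReal_exp]

/-- **GELFOND–SCHNEIDER: `γ₀ = e^{s₀} = β₀^{-i}` is transcendental** (`E`-free: the tree theorem for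
`exp` at `l = i s₀`, `e^l = β₀`, exponent `b = -i`). [cite: Gelfond1934] -/
theorem γ₀_transcendental : Transcendental ℚ (γ₀ : ℂ) := by
  have hl : (s₀ : ℂ) * I ≠ 0 := mul_ne_zero (by exact_mod_cast s₀_ne_zero) I_ne_zero
  have hb : (-I) ∉ Set.range ((↑) : ℚ → ℂ) := by
    rintro ⟨q, hq⟩
    have him := congrArg Complex.im hq
    simp at him
  have h := Literature.NumberTheory.Transcendental.gelfond_schneider_holds β₀_isAlgebraic alg_I.neg
    hb exp_s₀_mul_I hl
  have e : cexp (-I * ((s₀ : ℂ) * I)) = (γ₀ : ℂ) := by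
    rw [← exp_s₀]
    congr 1
    linear_combination (-(s₀ : ℂ)) * I_sq
  rwa [e] at h

/-- The logarithms `i s₀ = log β₀` and `iπ = log(-1)` are `ℚ`-free (`β₀` is not a root of unity).
[folklore] -/
theorem linearIndependent_s₀I_piI : LinearIndependent ℚ ![(s₀ : ℂ) * I, (Real.pi : ℂ) * I] := by
  rw [LinearIndependent.pair_iff]
  intro s t h
  rw [Rat.smul_def, Rat.smul_def] at h
  have him := congrArg Complex.im h
  simp at him
  by_cases hs : s = 0
  · subst hs
    simp [Real.pi_ne_zero] at him
    exact ⟨rfl, him⟩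
  · exfalso
    set q : ℚ := -t / s with hq
    have hsR : (s : ℝ) ≠ 0 := by exact_mod_cast hs
    have hs₀ : s₀ = (q : ℝ) * Real.pi := by
      rw [hq]
      push_cast
      field_simp
      linarith
    have hb : (q.den : ℝ) * s₀ = (q.num : ℝ) * Real.pi := by
      rw [hs₀, ← mul_assoc, mul_comm (q.den : ℝ)]
      congr 1
      exact_mod_cast Rat.mul_den_eq_num q
    have hpow : β₀ ^ (2 * q.den) = 1 := by
      rw [← exp_s₀_mul_I, ← Complex.exp_nat_mul]
      have e : ((2 * q.den : ℕ) : ℂ) * ((s₀ : ℂ) * I) = (q.num : ℂ) * (2 * Real.pi * I) := by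
        have hb' : ((q.den : ℝ) : ℂ) * (s₀ : ℂ) = ((q.num : ℝ) : ℂ) * (Real.pi : ℂ) := by
          exact_mod_cast congrArg ((↑) : ℝ → ℂ) hb
        push_cast at hb' ⊢
        linear_combination (2 * I) * hb'
      rw [e]
      exact Complex.exp_int_mul_two_pi_mul_I q.num
    exact β₀_pow_ne_one (by positivity) hpow

/-- **BAKER: `s₀ ∉ A ⊕ Aπ`** — from the `ℚ̄`-linear independence of `1, i s₀, iπ` (Baker's theorem
for the `ℚ`-free logarithms `i s₀, iπ` of the algebraic numbers `β₀, -1`). [cite: Baker1966, 68] -/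
theorem s₀_not_mem_spanOnePi : s₀ ∉ spanOnePi := by
  intro hmem
  obtain ⟨c, hc⟩ := (Submodule.mem_span_range_iff_exists_fun A).mp hmem
  rw [Fin.sum_univ_two] at hc
  simp only [Matrix.cons_val_zero, Matrix.cons_val_one, Algebra.smul_def, mul_one] at hc
  have hc' : (((c 0 : A) : ℝ) : ℂ) + (((c 1 : A) : ℝ) : ℂ) * (Real.pi : ℂ) = (s₀ : ℂ) := by
    rw [← hc]
    push_cast
    rfl
  let l : Fin 2 → ℂ := ![(s₀ : ℂ) * I, (Real.pi : ℂ) * I]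
  have halg : ∀ i, IsAlgebraic ℚ (cexp (l i)) := by
    intro i
    fin_cases i
    · simpa [l, exp_s₀_mul_I] using β₀_isAlgebraic
    · simpa [l, Complex.exp_pi_mul_I] using alg_neg_one
  have hB := baker_holds l halg linearIndependent_s₀I_piI
  have h0 : -(((c 0 : A) : ℝ) : ℂ) * I ∈ Qb :=
    mul_mem (neg_mem (mem_A_iff_coe_mem_Qb.mp (c 0).2)) I_mem_Qb
  have h1 : -(((c 1 : A) : ℝ) : ℂ) ∈ Qb := neg_mem (mem_A_iff_coe_mem_Qb.mp (c 1).2)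
  let g : Option (Fin 2) → Qb := fun o => o.elim ⟨_, h0⟩ ![(1 : Qb), ⟨_, h1⟩]
  have hsum : ∑ o, g o • (o.elim (1 : ℂ) l) = 0 := by
    rw [Fintype.sum_option, Fin.sum_univ_two]
    simp only [g, l, Option.elim, Matrix.cons_val_zero, Matrix.cons_val_one]
    rw [IntermediateField.smul_def, IntermediateField.smul_def, IntermediateField.smul_def]
    simp only [IntermediateField.coe_one]
    rw [← hc']
    ring
  have key := Fintype.linearIndependent_iff.mp hB g hsum (some 0)
  simp [g] at key

/-- `2s₀ ∉ A ⊕ Aπ`. [cite: Baker1966, 68] -/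
theorem two_mul_s₀_not_mem_spanOnePi : 2 * s₀ ∉ spanOnePi := by
  intro h
  apply s₀_not_mem_spanOnePi
  have h2 : ((2 : A)⁻¹ • (2 * s₀) : ℝ) ∈ spanOnePi := Submodule.smul_mem _ _ h
  have ha : algebraMap A ℝ ((2 : A)⁻¹) * 2 = 1 := by
    rw [← map_ofNat (algebraMap A ℝ) 2, ← map_mul, inv_mul_cancel₀ two_ne_zero, map_one]
  have e : ((2 : A)⁻¹ • (2 * s₀) : ℝ) = s₀ := by
    rw [Algebra.smul_def, ← mul_assoc, ha, one_mul]
  rwa [e] at h2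

/-- **THE DICHOTOMY: `γ₀ ∉ A ⊕ Aπ` or `γ₀² ∉ A ⊕ Aπ`** — if `γ₀ = a + bπ` and `γ₀² = c + dπ` then
`b²π² + (2ab - d)π + (a² - c) = 0`, so `b = 0` by the `A`-independence of `1, π, π²`, and `γ₀ = a`
would be algebraic, contradicting Gelfond–Schneider. (Which alternative holds is not decided here;
under Schanuel both do.) [folklore] -/
theorem γ₀_or_γ₀_sq_not_mem : γ₀ ∉ spanOnePi ∨ γ₀ ^ 2 ∉ spanOnePi := by
  by_contra! h
  obtain ⟨h1, h2⟩ := h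
  obtain ⟨c, hc⟩ := (Submodule.mem_span_range_iff_exists_fun A).mp h1
  obtain ⟨d, hd⟩ := (Submodule.mem_span_range_iff_exists_fun A).mp h2
  rw [Fin.sum_univ_two] at hc hd
  simp only [Matrix.cons_val_zero, Matrix.cons_val_one, Algebra.smul_def, mul_one,
    IntermediateField.algebraMap_apply] at hc hd
  let g : Fin 3 → A := ![c 0 ^ 2 - d 0, c 0 * c 1 + c 0 * c 1 - d 1, c 1 ^ 2]
  have hsum : ∑ i, g i • (![(1 : ℝ), Real.pi, Real.pi ^ 2] i) = 0 := by
    rw [Fin.sum_univ_three]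
    simp only [g, Matrix.cons_val_zero, Matrix.cons_val_one, Matrix.cons_val_two, Matrix.head_cons,
      Matrix.tail_cons, Algebra.smul_def, IntermediateField.algebraMap_apply, mul_one]
    push_cast
    linear_combination (((c 0 : A) : ℝ) + ((c 1 : A) : ℝ) * Real.pi + γ₀) * hc - hd
  have key := Fintype.linearIndependent_iff.mp linearIndependent_one_pi_piSq g hsum 2
  have hc1 : c 1 = 0 := by
    have : (c 1) ^ 2 = 0 := by simpa [g] using key
    exact pow_eq_zero_iff (n := 2) (by norm_num) |>.mp this
  rw [hc1] at hc
  simp at hc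
  -- hc : ↑(c 0) = γ₀
  have halg : IsAlgebraic ℚ ((((c 0 : A) : ℝ)) : ℂ) := mem_Qb_iff.mp (mem_A_iff_coe_mem_Qb.mp (c 0).2)
  rw [hc] at halg
  exact γ₀_transcendental halg

/-- `trdeg ℚ(x, b) ≤ 1` for `b` algebraic. [folklore] -/
theorem trdeg_adjoin_pair_le_one (x : ℂ) {b : ℂ} (hb : IsAlgebraic ℚ b) :
    Algebra.trdeg ℚ ↥(IntermediateField.adjoin ℚ ({x, b} : Set ℂ)) ≤ 1 := by
  let L : IntermediateField ℚ ℂ := IntermediateField.adjoin ℚ (Set.range ![x])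
  have hL : Algebra.trdeg ℚ L ≤ ((1 : ℕ) : Cardinal) := by
    refine (RootDecomp1BTameFlagCore.trdeg_adjoin_le_cardinalMk _).trans ?_
    refine Cardinal.mk_range_le.trans ?_
    simp
  have hxL : x ∈ L := IntermediateField.subset_adjoin ℚ _ ⟨0, rfl⟩
  have h : Algebra.trdeg ℚ ↥(IntermediateField.adjoin ℚ ({x, b} : Set ℂ)) ≤ Algebra.trdeg ℚ L := by
    refine RootDecomp1EAnchor.trdeg_adjoin_le_of_isAlgebraic (K := L) ?_
    intro y hy
    rcases hy with rfl | hy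
    · exact alg_of_mem hxL
    · rw [Set.mem_singleton_iff] at hy
      rw [hy]
      exact hb.tower_top (L := L)
  exact h.trans (by exact_mod_cast hL)

/-- FIRST ALTERNATIVE: if `γ₀ ∉ A ⊕ Aπ`, the pinned shear `γ₀ ↦ s₀` carries (E1)–(E4), (P1), (P2)
(and (P3) granted Nesterenko) and kills the length-one cell at `γ₀`: `E γ₀ = γ₀`, `E(iγ₀) = β₀`,
`trdeg ℚ(γ₀, iγ₀, γ₀, β₀) = 1`. [folklore] -/
theorem kFiveX_of_γ₀_not_mem (h : γ₀ ∉ spanOnePi) :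
    ∃ E : ℂ → ℂ, TranscendencePackage E ∧ TrueKernel E ∧ AgreesOnPeriodPlane E ∧
      (nesterenko → NesterenkoE E) ∧ ¬ KleinPolarCellOne E γ₀ ∧ ¬ KleinPolarE E := by
  refine kFiveX_reduction h s₀_not_mem_spanOnePi
    (IntermediateField.adjoin ℚ ({(γ₀ : ℂ), β₀} : Set ℂ)) (trdeg_adjoin_pair_le_one _ β₀_isAlgebraic)
    (IntermediateField.subset_adjoin ℚ _ (Set.mem_insert _ _)) ?_ ?_
  · rw [exp_s₀]
    exact IntermediateField.subset_adjoin ℚ _ (Set.mem_insert _ _)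
  · rw [exp_s₀_mul_I]
    exact IntermediateField.subset_adjoin ℚ _ (Set.mem_insert_of_mem _ rfl)

/-- SECOND ALTERNATIVE: if `γ₀² ∉ A ⊕ Aπ`, the pinned shear `γ₀² ↦ 2s₀` kills the length-one cell
at `γ₀²`: `E γ₀² = γ₀²`, `E(iγ₀²) = β₀²`. [folklore] -/
theorem kFiveX_of_γ₀_sq_not_mem (h : γ₀ ^ 2 ∉ spanOnePi) :
    ∃ E : ℂ → ℂ, TranscendencePackage E ∧ TrueKernel E ∧ AgreesOnPeriodPlane E ∧
      (nesterenko → NesterenkoE E) ∧ ¬ KleinPolarCellOne E (γ₀ ^ 2) ∧ ¬ KleinPolarE E := by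
  have hb : IsAlgebraic ℚ (β₀ ^ 2) := by
    rw [pow_two]
    exact β₀_isAlgebraic.mul β₀_isAlgebraic
  have e1 : cexp ((2 * s₀ : ℝ) : ℂ) = ((γ₀ ^ 2 : ℝ) : ℂ) := by
    push_cast
    rw [show (2 : ℂ) * (s₀ : ℂ) = (s₀ : ℂ) + (s₀ : ℂ) by ring, Complex.exp_add, exp_s₀]
    ring
  have e2 : cexp (((2 * s₀ : ℝ) : ℂ) * I) = β₀ ^ 2 := by
    push_cast
    rw [show (2 : ℂ) * (s₀ : ℂ) * I = (s₀ : ℂ) * I + (s₀ : ℂ) * I by ring, Complex.exp_add,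
      exp_s₀_mul_I]
    ring
  refine kFiveX_reduction h two_mul_s₀_not_mem_spanOnePi
    (IntermediateField.adjoin ℚ ({((γ₀ ^ 2 : ℝ) : ℂ), β₀ ^ 2} : Set ℂ)) (trdeg_adjoin_pair_le_one _ hb)
    (IntermediateField.subset_adjoin ℚ _ (Set.mem_insert _ _)) ?_ ?_
  · rw [e1]
    exact IntermediateField.subset_adjoin ℚ _ (Set.mem_insert _ _)
  · rw [e2]
    exact IntermediateField.subset_adjoin ℚ _ (Set.mem_insert_of_mem _ rfl)

/-- **K5-X (UNCONDITIONAL up to Nesterenko for (P3)): a model with (E1)–(E4), the true kernel,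
agreement with `exp` on `ℚ̄ ⊕ ℚ̄π` (and Nesterenko verbatim, granted `nesterenko`) FAILING A
LENGTH-ONE POLAR CELL** — at `r = γ₀` or at `r = γ₀²`. [folklore] -/
theorem kFiveX : ∃ (E : ℂ → ℂ) (r : ℝ), r ≠ 0 ∧ TranscendencePackage E ∧ TrueKernel E ∧
    AgreesOnPeriodPlane E ∧ (nesterenko → NesterenkoE E) ∧ ¬ KleinPolarCellOne E r ∧
    ¬ KleinPolarE E := by
  rcases γ₀_or_γ₀_sq_not_mem with h | h
  · obtain ⟨E, h1, h2, h3, h4, h5, h6⟩ := kFiveX_of_γ₀_not_mem h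
    exact ⟨E, γ₀, γ₀_pos.ne', h1, h2, h3, h4, h5, h6⟩
  · obtain ⟨E, h1, h2, h3, h4, h5, h6⟩ := kFiveX_of_γ₀_sq_not_mem h
    exact ⟨E, γ₀ ^ 2, (pow_pos γ₀_pos 2).ne', h1, h2, h3, h4, h5, h6⟩

/-- **THE FIRST POLAR CELL IS FALSE WITHOUT A CHANNEL BEYOND THE PERIOD PACKAGE** (K5-X settled):
granted Nesterenko's theorem (for (P3)), `¬ ∀ E, PeriodPackage E → ∀ r ≠ 0, X_E(1) at r`. Any proof
of `KleinPolarSchanuel` — indeed of its very first cell `trdeg ℚ(r, ir, e^r, e^{ir}) ≥ 2` — must use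
`exp` beyond LW/HL/GS/Baker/rank one/kernel/period plane/Nesterenko. Supersedes the conditional §8.
[cite: Nesterenko1996SbMath, Theorem 1 and its corollaries] -/
theorem kleinPolarCellOne_false_without_channel_beyond_periods (hN : nesterenko) :
    ¬ ∀ E : ℂ → ℂ, PeriodPackage E → ∀ r : ℝ, r ≠ 0 → KleinPolarCellOne E r := by
  intro h
  obtain ⟨E, r, hr, hT, hK, hP, hNE, hcell, -⟩ := kFiveX
  exact hcell (h E ⟨hT, hK, hP, hNE hN⟩ r hr)

/-- HYPOTHESIS-FREE FORM ((P3) dropped from the model class): `¬ ∀ E, (E1)–(E4) → (P1) → (P2) →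
∀ r ≠ 0, X_E(1) at r` — no named fact is assumed. [folklore] -/
theorem kleinPolarCellOne_false_without_channel_beyond_kernel_and_period_plane :
    ¬ ∀ E : ℂ → ℂ, TranscendencePackage E → TrueKernel E → AgreesOnPeriodPlane E →
      ∀ r : ℝ, r ≠ 0 → KleinPolarCellOne E r := by
  intro h
  obtain ⟨E, r, hr, hT, hK, hP, -, hcell, -⟩ := kFiveX
  exact hcell (h E hT hK hP r hr)

/-- DICTIONARY: at `E = exp` every length-one cell (`r ≠ 0`) is a case of the crux
`KleinPolarSchanuel` — so the cell the model kills (at `γ₀` or `γ₀²`) is, for `exp`, an OPEN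
instance of Schanuel's conjecture (`trdeg ℚ(γ₀, e^{γ₀}, e^{iγ₀}) ≥ 2` is not known), consistent
with the floor. [folklore] -/
theorem kleinPolarCellOne_exp_γ₀_of_kleinPolarSchanuel
    (hX : Summit.Schanuel.Schanuel.Theses.RootDecomp1B.KleinPolarSchanuel) :
    KleinPolarCellOne cexp γ₀ ∧ KleinPolarCellOne cexp (γ₀ ^ 2) :=
  ⟨kleinPolarCellOne_of_kleinPolarE ((kleinPolarE_exp_iff).mpr hX) γ₀_pos.ne',
    kleinPolarCellOne_of_kleinPolarE ((kleinPolarE_exp_iff).mpr hX) (pow_pos γ₀_pos 2).ne'⟩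

end Summit.Schanuel.Schanuel.Theorems.RootDecomp1BFinitePinningFloor

end
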